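import Mathlib.Analysis.Normed.Module.Connected
import Literature.Analysis.PDE.HopfMinimumPrinciple
import Literature.Analysis.PDE.LaplacianInequalities
import Literature.Analysis.FluidPDE.NewtonKernel
import Literature.Geometry.Lorentzian.Basic
import HarnessLib

/-!
# Harmonic functions on `ℝ³ ∖ {0}` with two ends: `ψ = a + b/|y|`
# (the last step of the case of equality of Bray's Theorem 9)

Bray, J. Differential Geom. 59 (2001), §6, proof of Thm. 9, case of equality, last paragraph:
*"Since `(M̄³_Σ, ḡ)` has two ends, it must be conformal to `(ℝ³ ∖ {0}, δ)`, and since it has zero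
scalar curvature, it follows from equation [`R(u⁴ δ) = −8u⁻⁵ Δu`, Appendix A] that it must be a
Schwarzschild metric. Hence, in the case of equality, `(M³, g)` must be a Schwarzschild manifold
outside `Σ`."* Spelled out: `ḡ = ψ⁴ δ` on `ℝ³ ∖ {0}` with `ψ > 0`; zero scalar curvature means
`Δ_δ ψ = 0`; the two asymptotically flat ends of the doubled manifold are `|y| → ∞`, where
`ψ → a > 0`, and `y → 0`, which in the inverted chart `z = y/|y|²` reads `ḡ = (|y| ψ(y))⁴ |dz|²`,
so that `|y| ψ(y) → b > 0`; the conclusion is `ψ = a + b/|y|`, i.e. `ḡ = (a + b/|y|)⁴ δ`, the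
Schwarzschild metric of mass `2ab` ((12): after the rescaling `y = a⁻² z`,
`(1 + ab/|z|)⁴ δ`). Classically this is Bôcher's theorem on positive harmonic functions at an
isolated singularity followed by Liouville's theorem (Axler–Bourdon–Ramey, *Harmonic Function
Theory*, Thm. 3.9 and Cor. 3.14); with the behaviour at *both* ends given, as here, it is the
uniqueness of the two-ended Dirichlet problem, which this file proves from E. Hopf's maximum
principle (`Literature.Analysis.PDE.hopf_minimumPrinciple`, López-Gómez 2012, Thm. 1.2) with the
barriers `ε (1 + 1/|y|)`:

* `isPreconnected_openAnnulus` — the open annulus `{δ < |y| < R}` of `ℝ³` is preconnected;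
* `harmonicOnNhd_inv_norm` — `1/|y|` is harmonic on `ℝ³ ∖ {0}` (it is `−4π Γ`, `Γ` the Newtonian
  kernel of `Literature/Analysis/FluidPDE/NewtonKernel`);
* `eqOn_of_harmonicOnNhd_of_isMaxOn` — **strong maximum principle for harmonic functions on a
  preconnected open set** of `ℝ³` (E. Hopf): an interior maximum point makes the function
  constant;
* `nonpos_of_harmonicOnNhd_two_ended`, `eq_zero_of_harmonicOnNhd_two_ended` — **two-ended
  maximum principle**: a function harmonic on `ℝ³ ∖ {0}` with `w → 0` as `|y| → ∞` and
  `|y| w(y) → 0` as `y → 0` vanishes identically (compare with `±ε(1 + 1/|y|)` on annuli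
  `δ ≤ |y| ≤ R` and let `ε → 0`);
* `eq_const_add_mul_inv_norm_of_harmonicOnNhd` — **main theorem**: `ψ` harmonic on `ℝ³ ∖ {0}`,
  `ψ → a` as `|y| → ∞`, `|y| ψ(y) → b` as `y → 0` ⟹ `ψ(y) = a + b/|y|` for all `y ≠ 0`.

Everything is proved; no definitions and no named facts are introduced. (In support of the named
fact `Bray2001_capacity_rigidity`, `MassCapacity.lean`: this is the step that turns "conformally
flat, scalar flat, two-ended" into "Schwarzschild"; the identification of the mass parameter
with the ADM energy is `MassCapacityRigidityMass.lean`.)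

## References

* H. L. Bray, *Proof of the Riemannian Penrose inequality using the positive mass theorem*,
  J. Differential Geom. 59 (2001) 177–267 (arXiv:math/9911173): §6, proof of Thm. 9, last
  paragraph; §1 (12); Appendix A (scalar curvature of `u⁴ g`). (key `BrayRPI2001`)
* S. Axler, P. Bourdon, W. Ramey, *Harmonic Function Theory*, 2nd ed., GTM 137, Springer 2001,
  Thm. 3.9 (Bôcher) and Cor. 3.14.
* J. López-Gómez, *Linear Second Order Elliptic Operators*, World Scientific (2012; © 2013),
  Ch. 1, Thm. 1.2 (minimum principle of E. Hopf). (key `LopezGomez2012`)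
-/

noncomputable section

open Set Filter Metric Topology Bornology InnerProductSpace
open scoped Real Laplacian

namespace Literature.Geometry.Lorentzian

open Literature.Analysis.PDE Literature.Analysis.FluidPDE

/-! ### The open annulus -/

/-- The open annulus `{δ < ‖y‖ < R}` of `ℝ³` (`δ > 0`) is the image of `sphere × (δ, R)` under
`(u, r) ↦ r • u`, hence preconnected (the unit sphere of `ℝ³` is preconnected). [folklore] -/
theorem isPreconnected_openAnnulus {δ R : ℝ} (hδ : 0 < δ) :
    IsPreconnected {y : E3 | δ < ‖y‖ ∧ ‖y‖ < R} := by
  have himage : {y : E3 | δ < ‖y‖ ∧ ‖y‖ < R} =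
      (fun p : E3 × ℝ ↦ p.2 • p.1) '' (sphere (0 : E3) 1 ×ˢ Ioo δ R) := by
    ext x
    simp only [mem_setOf_eq, mem_image, mem_prod, mem_sphere_zero_iff_norm, mem_Ioo,
      Prod.exists]
    constructor
    · rintro ⟨hδ', hR⟩
      have hx0 : 0 < ‖x‖ := hδ.trans hδ'
      refine ⟨‖x‖⁻¹ • x, ‖x‖, ⟨?_, hδ', hR⟩, ?_⟩
      · rw [norm_smul, norm_inv, norm_norm, inv_mul_cancel₀ hx0.ne']
      · rw [smul_smul, mul_inv_cancel₀ hx0.ne', one_smul]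
    · rintro ⟨y, r, ⟨hy, hδr, hrR⟩, rfl⟩
      have hr : 0 < r := hδ.trans hδr
      rw [norm_smul, Real.norm_of_nonneg hr.le, hy, mul_one]
      exact ⟨hδr, hrR⟩
  rw [himage]
  have hE : 1 < Module.rank ℝ E3 :=
    Module.one_lt_rank_of_one_lt_finrank (by rw [finrank_euclideanSpace_fin]; norm_num)
  exact ((isPreconnected_sphere hE 0 1).prod isPreconnected_Ioo).image _
    (continuous_snd.smul continuous_fst).continuousOn

/-! ### `1/|y|` is harmonic off the origin -/

/-- `1/‖y‖ = −4π Γ(y)` is harmonic on `ℝ³ ∖ {0}` (`Γ(z) = −(4π‖z‖)⁻¹` the Newtonian kernel,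
`harmonicOnNhd_newtonKernel`). [folklore] -/
theorem harmonicOnNhd_inv_norm : HarmonicOnNhd (fun y : E3 ↦ ‖y‖⁻¹) ({0}ᶜ : Set E3) := by
  have h : (fun y : E3 ↦ ‖y‖⁻¹) = (-(4 * π)) • newtonKernel := by
    ext y
    rw [Pi.smul_apply, smul_eq_mul, newtonKernel_eq, mul_inv, mul_neg, neg_mul, neg_neg,
      ← mul_assoc, mul_inv_cancel₀ (by positivity : (4 * π : ℝ) ≠ 0), one_mul]
  rw [h]
  exact harmonicOnNhd_newtonKernel.const_smul

/-- `a + b/‖y‖` is harmonic on `ℝ³ ∖ {0}`. [folklore] -/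
theorem harmonicOnNhd_const_add_mul_inv_norm (a b : ℝ) :
    HarmonicOnNhd (fun y : E3 ↦ a + b * ‖y‖⁻¹) ({0}ᶜ : Set E3) := by
  have h : (fun y : E3 ↦ a + b * ‖y‖⁻¹) = (fun _ ↦ a) + b • (fun y : E3 ↦ ‖y‖⁻¹) := by
    ext y
    simp
  rw [h]
  exact fun x hx ↦ (harmonicAt_const a).add (harmonicOnNhd_inv_norm x hx).const_smul

/-! ### The strong maximum principle for harmonic functions (E. Hopf) -/

/-- **Strong maximum principle for harmonic functions on `ℝ³`.** If `q` is harmonic on a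
preconnected open set `A ⊆ ℝ³` and attains its maximum over `A` at a point `z ∈ A`, then `q` is
constant on `A`. (E. Hopf's minimum principle `hopf_minimumPrinciple` for the operator
`−Δ = −∑ δᵢⱼ ∂ᵢⱼ` applied to `u = q(z) − q ≥ 0`, whose Laplacian `∑ᵢ ∂ᵢᵢ u = Δu = 0` is computed
in the standard orthonormal basis.) López-Gómez 2012, Thm. 1.2; Gilbarg–Trudinger, Thm. 3.5.
[cite: LopezGomez2012, Thm. 1.2] -/
theorem eqOn_of_harmonicOnNhd_of_isMaxOn {A : Set E3} (hA : IsOpen A) (hconn : IsPreconnected A)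
    {q : E3 → ℝ} (hq : HarmonicOnNhd q A) {z : E3} (hz : z ∈ A) (hmax : IsMaxOn q A z) :
    ∀ y ∈ A, q y = q z := by
  set u : E3 → ℝ := fun y ↦ q z - q y with hu_def
  have hu_harm : ∀ x ∈ A, HarmonicAt u x := fun x hx ↦ (harmonicAt_const (q z)).sub (hq x hx)
  have hu2 : ContDiffOn ℝ 2 u A := fun x hx ↦ (hu_harm x hx).1.contDiffWithinAt
  -- `∑ᵢ ∂ᵢᵢ u = Δ u = 0` on `A`
  have hsum : ∀ x ∈ A, ∑ i : Fin 3, fderiv ℝ (fderiv ℝ u) x (EuclideanSpace.single i 1)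
      (EuclideanSpace.single i 1) = 0 := by
    intro x hx
    have hΔ : (Δ u) x = 0 := (hu_harm x hx).2.self_of_nhds
    rw [laplacian_eq_sum_of_contDiffAt (EuclideanSpace.basisFun (Fin 3) ℝ) (hu_harm x hx).1]
      at hΔ
    rw [← hΔ]
    refine Finset.sum_congr rfl fun i _ ↦ ?_
    rw [fderiv_fderiv_apply_eq_fderiv_fderiv (hu_harm x hx).1]
    simp
  have key := hopf_minimumPrinciple (N := 3) hA hconn
    (a := fun _ i j ↦ if i = j then (1 : ℝ) else 0) (b := fun _ _ ↦ (0 : ℝ)) (c := fun _ ↦ (0 : ℝ))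
    (u := u) (μ := 1) (m := 0)
    (fun _ _ i j ↦ by simp only [eq_comm]) one_pos
    (fun _ _ ξ ↦ by
      rw [one_mul, EuclideanSpace.real_norm_sq_eq]
      refine le_of_eq (Finset.sum_congr rfl fun i _ ↦ ?_)
      simp only [ite_mul, one_mul, zero_mul, Finset.sum_ite_eq, Finset.mem_univ, if_true]
      ring)
    (fun _ _ _ ↦ ⟨1, fun _ _ ↦ ⟨fun i j ↦ by split_ifs <;> simp, fun _ ↦ by simp, by simp⟩⟩)
    (fun _ _ ↦ le_rfl) hu2
    (fun x hx ↦ by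
      simp only [ite_mul, one_mul, zero_mul, Finset.sum_ite_eq, Finset.mem_univ, if_true,
        Finset.sum_const_zero, add_zero, hsum x hx, neg_zero, le_refl])
    le_rfl (fun x hx ↦ sub_nonneg.2 (hmax hx)) hz (sub_self _)
  intro y hy
  have := key y hy
  simp only [hu_def] at this
  linarith

/-! ### The two-ended maximum principle on `ℝ³ ∖ {0}` -/

/-- **Two-ended maximum principle, one-sided form.** Let `w` be harmonic on `ℝ³ ∖ {0}` with
`w(y) → 0` as `|y| → ∞` and `|y| w(y) → 0` as `y → 0`. Then `w ≤ 0` on `ℝ³ ∖ {0}`. Proof: for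
`ε > 0` the function `q = w − ε(1 + 1/|y|)` is harmonic on `ℝ³ ∖ {0}`, negative for `|y|` large
(`w < ε` there) and for `|y|` small (`|y| w(y) < ε` there); if `q(y₀) > 0`, the maximum of `q`
over a closed annulus `δ ≤ |y| ≤ R` containing `y₀` and both regions where `q < 0` is attained
in the open annulus, so `q` is a positive constant there by the strong maximum principle —
contradicting `q < 0` near the outer sphere. Hence `w(y₀) ≤ ε(1 + 1/|y₀|)` for every `ε > 0`.
[folklore] -/
theorem nonpos_of_harmonicOnNhd_two_ended {w : E3 → ℝ} (hw : HarmonicOnNhd w ({0}ᶜ : Set E3))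
    (hinf : Tendsto w (cobounded E3) (𝓝 0))
    (hzero : Tendsto (fun y ↦ ‖y‖ * w y) (𝓝[≠] 0) (𝓝 0)) {y₀ : E3} (hy₀ : y₀ ≠ 0) :
    w y₀ ≤ 0 := by
  have hn0 : 0 < ‖y₀‖ := norm_pos_iff.2 hy₀
  -- it suffices to bound `w y₀` by `ε (1 + 1/‖y₀‖)` for every `ε > 0`
  suffices key : ∀ ε : ℝ, 0 < ε → w y₀ ≤ ε * (1 + ‖y₀‖⁻¹) by
    by_contra hpos
    push Not at hpos
    have h1 : 0 < 1 + ‖y₀‖⁻¹ := by positivity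
    have h2 := key (w y₀ / (2 * (1 + ‖y₀‖⁻¹))) (by positivity)
    have h3 : w y₀ / (2 * (1 + ‖y₀‖⁻¹)) * (1 + ‖y₀‖⁻¹) = w y₀ / 2 := by
      field_simp
    linarith
  intro ε hε
  -- the comparison function
  set q : E3 → ℝ := fun y ↦ w y - ε * (1 + ‖y‖⁻¹) with hq_def
  have hq_harm : HarmonicOnNhd q ({0}ᶜ : Set E3) := by
    have h : q = w - fun y : E3 ↦ ε + ε * ‖y‖⁻¹ := by
      ext y
      simp only [hq_def, Pi.sub_apply]
      ring
    rw [h]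
    exact hw.sub (harmonicOnNhd_const_add_mul_inv_norm ε ε)
  -- far out `w < ε`
  obtain ⟨R₀, hR₀⟩ : ∃ R₀ : ℝ, ∀ y : E3, R₀ ≤ ‖y‖ → w y < ε := by
    have hev : ∀ᶠ y in cobounded E3, w y < ε := hinf.eventually (gt_mem_nhds hε)
    obtain ⟨r, -, hr⟩ := (hasBasis_cobounded_compl_closedBall (0 : E3)).eventually_iff.1 hev
    refine ⟨r + 1, fun y hy ↦ hr ?_⟩
    simp only [mem_compl_iff, mem_closedBall, dist_zero_right, not_le]
    linarith
  -- near the origin `‖y‖ w y < ε`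
  obtain ⟨δ₀, hδ₀, hδ₀'⟩ : ∃ δ₀ > 0, ∀ y : E3, y ≠ 0 → ‖y‖ < δ₀ → ‖y‖ * w y < ε := by
    have hev : ∀ᶠ y in 𝓝[≠] (0 : E3), ‖y‖ * w y < ε := hzero.eventually (gt_mem_nhds hε)
    rw [eventually_nhdsWithin_iff, Metric.eventually_nhds_iff] at hev
    obtain ⟨δ₀, hδ₀, h⟩ := hev
    exact ⟨δ₀, hδ₀, fun y hy hyd ↦ h (by rwa [dist_zero_right]) hy⟩
  -- the radii of the annulus
  set δ : ℝ := min (δ₀ / 2) (‖y₀‖ / 2) with hδ_def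
  set R : ℝ := max R₀ ‖y₀‖ + 1 with hR_def
  have hδpos : 0 < δ := lt_min (by positivity) (by positivity)
  have hδy₀ : δ < ‖y₀‖ := (min_le_right _ _).trans_lt (by linarith)
  have hδδ₀ : δ < δ₀ := (min_le_left _ _).trans_lt (by linarith)
  have hR₀R : R₀ ≤ R - 1 := by rw [hR_def]; linarith [le_max_left R₀ ‖y₀‖]
  have hy₀R : ‖y₀‖ < R := by rw [hR_def]; linarith [le_max_right R₀ ‖y₀‖]
  -- `q < 0` far out and near the origin
  have hq_far : ∀ y : E3, R₀ ≤ ‖y‖ → q y < 0 := by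
    intro y hy
    have h1 := hR₀ y hy
    have h2 : 0 ≤ ε * ‖y‖⁻¹ := by positivity
    simp only [hq_def]
    nlinarith
  have hq_near : ∀ y : E3, y ≠ 0 → ‖y‖ ≤ δ → q y < 0 := by
    intro y hy hyδ
    have hny : 0 < ‖y‖ := norm_pos_iff.2 hy
    have h1 : ‖y‖ * w y < ε := hδ₀' y hy (by linarith)
    have h2 : w y < ε * ‖y‖⁻¹ := by
      rw [← div_eq_mul_inv, lt_div_iff₀ hny, mul_comm]
      exact h1
    simp only [hq_def]
    nlinarith
  -- the closed annulus `K` and the open annulus `A`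
  set K : Set E3 := {y | δ ≤ ‖y‖ ∧ ‖y‖ ≤ R} with hK_def
  set A : Set E3 := {y | δ < ‖y‖ ∧ ‖y‖ < R} with hA_def
  have hKc : IsCompact K :=
    (isCompact_closedBall (0 : E3) R).of_isClosed_subset
      ((isClosed_le continuous_const continuous_norm).inter
        (isClosed_le continuous_norm continuous_const))
      fun y hy ↦ mem_closedBall_zero_iff.2 hy.2
  have hK0 : K ⊆ ({0}ᶜ : Set E3) := by
    intro y hy h0
    rw [mem_singleton_iff] at h0
    have h1 : δ ≤ ‖y‖ := hy.1
    rw [h0, norm_zero] at h1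
    linarith
  have hAK : A ⊆ K := fun y hy ↦ ⟨hy.1.le, hy.2.le⟩
  have hAo : IsOpen A :=
    (isOpen_lt continuous_const continuous_norm).inter (isOpen_lt continuous_norm continuous_const)
  have hqK : ContinuousOn q K := hq_harm.contDiffOn.continuousOn.mono hK0
  have hy₀K : y₀ ∈ K := ⟨hδy₀.le, hy₀R.le⟩
  obtain ⟨z, hzK, hzmax⟩ := hKc.exists_isMaxOn ⟨y₀, hy₀K⟩ hqK
  -- suppose, for contradiction, that `q y₀ > 0`
  by_contra hcon
  have hqy₀ : 0 < q y₀ := by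
    simp only [hq_def]
    push Not at hcon
    linarith
  have hqz : 0 < q z := hqy₀.trans_le (hzmax hy₀K)
  have hz0 : z ≠ 0 := hK0 hzK
  -- the maximum point lies in the open annulus
  have hzA : z ∈ A := by
    refine ⟨lt_of_le_of_ne hzK.1 ?_, lt_of_le_of_ne hzK.2 ?_⟩
    · intro h
      exact absurd (hq_near z hz0 h.symm.le) (not_lt.2 hqz.le)
    · intro h
      have : R₀ ≤ ‖z‖ := by rw [h]; linarith
      exact absurd (hq_far z this) (not_lt.2 hqz.le)
  -- so `q` is constant on `A` (strong maximum principle)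
  have hconst := eqOn_of_harmonicOnNhd_of_isMaxOn hAo (isPreconnected_openAnnulus hδpos)
    (hq_harm.mono (hAK.trans hK0)) hzA (hzmax.on_subset hAK)
  -- contradiction at a point of `A` beyond `R₀`
  set y₁ : E3 := ((R - 1 / 2) * ‖y₀‖⁻¹) • y₀ with hy₁_def
  have hR1 : ‖y₀‖ + 1 ≤ R := by rw [hR_def]; linarith [le_max_right R₀ ‖y₀‖]
  have hRpos : 0 < R - 1 / 2 := by linarith
  have hny₁ : ‖y₁‖ = R - 1 / 2 := by
    rw [hy₁_def, norm_smul, Real.norm_of_nonneg (by positivity), mul_assoc,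
      inv_mul_cancel₀ hn0.ne', mul_one]
  have hy₁A : y₁ ∈ A := ⟨by rw [hny₁]; linarith, by rw [hny₁]; linarith⟩
  have h1 := hconst y₁ hy₁A
  have h2 := hq_far y₁ (by rw [hny₁]; linarith)
  linarith

/-- **Two-ended maximum principle.** A function harmonic on `ℝ³ ∖ {0}` which tends to `0` at
infinity and is `o(1/|y|)` at the origin vanishes identically (apply
`nonpos_of_harmonicOnNhd_two_ended` to `w` and `−w`). [folklore] -/
theorem eq_zero_of_harmonicOnNhd_two_ended {w : E3 → ℝ} (hw : HarmonicOnNhd w ({0}ᶜ : Set E3))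
    (hinf : Tendsto w (cobounded E3) (𝓝 0))
    (hzero : Tendsto (fun y ↦ ‖y‖ * w y) (𝓝[≠] 0) (𝓝 0)) {y : E3} (hy : y ≠ 0) : w y = 0 := by
  refine le_antisymm (nonpos_of_harmonicOnNhd_two_ended hw hinf hzero hy) ?_
  have hinf' : Tendsto (-w) (cobounded E3) (𝓝 0) := by
    have h := hinf.neg
    rw [neg_zero] at h
    exact h
  have hzero' : Tendsto (fun y ↦ ‖y‖ * (-w) y) (𝓝[≠] 0) (𝓝 0) := by
    simpa [mul_neg] using hzero.neg
  have := nonpos_of_harmonicOnNhd_two_ended hw.neg hinf' hzero' hy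
  simp only [Pi.neg_apply] at this
  linarith

/-! ### Harmonic functions on `ℝ³ ∖ {0}` with prescribed behaviour at both ends -/

/-- **Harmonic functions on `ℝ³ ∖ {0}` with two ends are `a + b/|y|`** (the last step of the
proof of the case of equality of Bray's Theorem 9: a scalar flat metric `ψ⁴ δ` on `ℝ³ ∖ {0}` with
two asymptotically flat ends is the Schwarzschild metric `(a + b/|y|)⁴ δ`, of mass `2ab`). Let
`ψ` be harmonic on `ℝ³ ∖ {0}` (`Δ_δ ψ = 0`, i.e. `R(ψ⁴ δ) = 0` where `ψ > 0`) with `ψ(y) → a` as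
`|y| → ∞` and `|y| ψ(y) → b` as `y → 0`, `y ≠ 0` (the limits expressing that `ψ⁴ δ` is
asymptotically flat at the end `|y| → ∞` and, in the inverted chart `z = y/|y|²`, at the end
`y → 0`). Then `ψ(y) = a + b/|y|` for every `y ≠ 0`: the difference `w = ψ − a − b/|y|` is harmonic
on `ℝ³ ∖ {0}` with `w → 0` at infinity and `|y| w(y) → 0` at the origin, hence zero by the
two-ended maximum principle. (Classically: Bôcher's theorem and Liouville's theorem,
Axler–Bourdon–Ramey Thm. 3.9, Cor. 3.14.) Bray 2001, §6, proof of Thm. 9, last paragraph ("it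
must be a Schwarzschild metric"). [cite: BrayRPI2001, §6 Thm. 9, proof of the case of equality
(last paragraph), with §1 (12)] -/
theorem eq_const_add_mul_inv_norm_of_harmonicOnNhd {ψ : E3 → ℝ}
    (hψ : HarmonicOnNhd ψ ({0}ᶜ : Set E3)) {a b : ℝ} (hinf : Tendsto ψ (cobounded E3) (𝓝 a))
    (hzero : Tendsto (fun y ↦ ‖y‖ * ψ y) (𝓝[≠] 0) (𝓝 b)) {y : E3} (hy : y ≠ 0) :
    ψ y = a + b * ‖y‖⁻¹ := by
  set w : E3 → ℝ := fun y ↦ ψ y - (a + b * ‖y‖⁻¹) with hw_def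
  have hw : HarmonicOnNhd w ({0}ᶜ : Set E3) := by
    have h : w = ψ - fun y : E3 ↦ a + b * ‖y‖⁻¹ := rfl
    rw [h]
    exact hψ.sub (harmonicOnNhd_const_add_mul_inv_norm a b)
  -- `w → 0` at infinity
  have hinv : Tendsto (fun y : E3 ↦ ‖y‖⁻¹) (cobounded E3) (𝓝 0) :=
    tendsto_norm_cobounded_atTop.inv_tendsto_atTop
  have hwinf : Tendsto w (cobounded E3) (𝓝 0) := by
    have h := hinf.sub (tendsto_const_nhds.add (hinv.const_mul b) :
      Tendsto (fun y : E3 ↦ a + b * ‖y‖⁻¹) (cobounded E3) (𝓝 (a + b * 0)))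
    rw [mul_zero, add_zero, sub_self] at h
    exact h
  -- `‖y‖ w y → 0` at the origin
  have hwzero : Tendsto (fun y ↦ ‖y‖ * w y) (𝓝[≠] 0) (𝓝 0) := by
    have hnorm : Tendsto (fun y : E3 ↦ a * ‖y‖) (𝓝[≠] 0) (𝓝 0) := by
      have h := ((continuous_norm.tendsto (0 : E3)).const_mul a)
      rw [norm_zero, mul_zero] at h
      exact tendsto_nhdsWithin_of_tendsto_nhds h
    have h := (hzero.sub hnorm).sub (tendsto_const_nhds (x := b))
    rw [sub_zero, sub_self] at h
    refine h.congr' ?_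
    filter_upwards [self_mem_nhdsWithin] with z hz
    have hnz : ‖z‖ ≠ 0 := norm_ne_zero_iff.2 hz
    simp only [hw_def]
    field_simp
    ring
  have h := eq_zero_of_harmonicOnNhd_two_ended hw hwinf hwzero hy
  simp only [hw_def] at h
  linarith

/-- The same with the limit at the origin along the full neighbourhood filter and the conclusion
written with `b / ‖y‖`. [cite: BrayRPI2001, §6 Thm. 9, proof of the case of equality (last
paragraph)] -/
theorem eq_const_add_div_norm_of_harmonicOnNhd {ψ : E3 → ℝ}
    (hψ : HarmonicOnNhd ψ ({0}ᶜ : Set E3)) {a b : ℝ} (hinf : Tendsto ψ (cobounded E3) (𝓝 a))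
    (hzero : Tendsto (fun y ↦ ‖y‖ * ψ y) (𝓝[≠] 0) (𝓝 b)) :
    ∀ y : E3, y ≠ 0 → ψ y = a + b / ‖y‖ := fun y hy ↦ by
  rw [div_eq_mul_inv]
  exact eq_const_add_mul_inv_norm_of_harmonicOnNhd hψ hinf hzero hy

end Literature.Geometry.Lorentzian

end
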